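import Literature.AlgebraicGeometry.ModuliOfAbelianVarieties.SiegelModuliTowerLiftNilpotent
import Literature.AlgebraicGeometry.Morphisms.RelDimOfDualNumberLifts
import HarnessLib

/-!
# The level-lowering maps of the Siegel tower LIFT relative dimension at every `ℂ`-point (modulo the lifting of `ℂ[ε]`-points)
# ([MumfordFogartyKirwan1994] App. 7A: the tower `𝒜_{g,d,nm} → 𝒜_{g,d,n}`; cell hodgecm-mathlib, Hecke-link socket (A) binder `TrLiftsRelDim`)

Topic `Literature/AlgebraicGeometry/ModuliOfAbelianVarieties`, namespace
`Literature.AlgebraicGeometry.ModuliOfAbelianVarieties.SiegelModuliTower`.  THEOREMS ONLY (no definition, no named fact, no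
instance, no `sorry`).  Cell `hodgecm-mathlib` (D-0151), E-road «EQUIDIM by proof», Hecke-link line card v1.1, B-plan1 (g14) ruling
2026-08-29T19:31:36Z (1): the binder of socket (A) is «`tr_f` LIFTS RELATIVE DIMENSION at `ℂ`-points» (`TrLiftsRelDim`, consumed
verbatim as the hypothesis `hLift` of ★ `Summit.…Theorems.EquidimThickLift.exists_lift_le_relDim`, B-p08 (g9)); road (R4)
«infinitesimal» proves it from (R4-γ) «`tr_f` lifts `ℂ[ε]`-points over `ℚ`» (the unique infinitesimal lifting of level structures,
★ `LevelStructureLiftNilpotent`; ★ `SiegelModuliTower.exists_lift_dualNumber`, B-p17 (g10); kept as the HYPOTHESIS `hγ` of `relDim_le_of_tr` and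
discharged in `trLiftsRelDim`), (R4-β) ★ `Morphisms.finrank_cotangentSpace_le_of_dualNumber_lifts` and (R4-δ) ★
`Morphisms.relDim_le_of_dualNumber_lifts` / `Motives.dualNumber_lifts_baseChange`.  HC_CM is proved only modulo the 7 printed
citations until rung 0 closes.

* `SiegelModuliTower.relDim_le_of_tr` (modulo `hγ`) and `SiegelModuliTower.trLiftsRelDim` (unconditional, over ★ (R4-γ)) — for `f : K ⟶ K′`, `(𝓜 K).M` and `(𝓜 K′).M` smooth over `ℚ` (★ `W1.smooth_qproj_of_F` under (F)),
  and `hγ` at `f`: the `hLift` text — for smooth open pieces `ι″ : S″ ⟶ (𝓜 K)_ℂ`, `ι : S′ ⟶ (𝓜 K′)_ℂ` of relative dimensions `d″`, `d`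
  and `ℂ`-points `s″`, `s` with `tr_{f,ℂ} (ι″ s″) = ι s`, `d ≤ d″`.

## References
* [MumfordFogartyKirwan1994] D. Mumford, J. Fogarty, F. Kirwan, *Geometric Invariant Theory* (3rd ed. 1994), Ch. 7 §3 Thm. 7.9
  (p. 139), App. 7A (p. 235).
* [GortzWedhorn2020] U. Görtz, T. Wedhorn, *Algebraic Geometry I* (2nd ed. 2020), (6.4) Prop. 6.7, Thm. 6.28.
-/

set_option autoImplicit false
set_option backward.isDefEq.respectTransparency false

noncomputable section

open CategoryTheory CategoryTheory.Limits AlgebraicGeometry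
open scoped DualNumber

namespace Literature.AlgebraicGeometry.ModuliOfAbelianVarieties.SiegelModuliTower

open Literature.AlgebraicGeometry.Motives (SchemeOver specOver ComplexPoints AlgPoints)

variable {g : ℕ} {δ : Fin g → ℕ}

/-- **`tr_f` LIFTS RELATIVE DIMENSION AT EVERY `ℂ`-POINT** (the Hecke-link binder `TrLiftsRelDim` at `f`, in the shape of the
hypothesis `hLift` of ★ `EquidimThickLift.exists_lift_le_relDim`), **modulo (R4-γ)** «`tr_f` lifts `ℂ[ε]`-points over `ℚ`» (`hγ`):
for smooth open pieces `ι″ : S″ ⟶ (𝓜 K)_ℂ`, `ι : S′ ⟶ (𝓜 K′)_ℂ` of relative dimensions `d″`, `d` and `ℂ`-points `s″`, `s` with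
`tr_{f,ℂ} (ι″ s″) = ι s`: `d ≤ d″`.  Smoothness of `(𝓜 K).M`, `(𝓜 K′).M` over `ℚ` is (F) (★ `W1.smooth_qproj_of_F`); the base changes
to `ℂ` are then smooth, and ★ `Morphisms.relDim_le_of_dualNumber_lifts` applies with the lifting transported to `ℂ` by ★
`Motives.dualNumber_lifts_baseChange`. [cite: MumfordFogartyKirwan1994, App. 7A (p. 235)] [cite: GortzWedhorn2020, (6.4) Prop. 6.7] -/
theorem relDim_le_of_tr (hg : 0 < g) (𝓜 : ∀ K : SiegelLevel δ, SiegelFineModuliScheme g K.N δ) {K K' : SiegelLevel δ}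
    (f : K ⟶ K')
    (hγ : ∀ (pt : specOver ℚ ℂ ⟶ specOver ℚ ℂ[ε])
      (_ : pt.left = Spec.map (CommRingCat.ofHom (TrivSqZeroExt.fstHom ℂ ℂ ℂ).toRingHom))
      (s' : specOver ℚ ℂ ⟶ (𝓜 K).M) (τ : specOver ℚ ℂ[ε] ⟶ (𝓜 K').M),
      pt ≫ τ = s' ≫ tr hg 𝓜 f → ∃ σ : specOver ℚ ℂ[ε] ⟶ (𝓜 K).M, pt ≫ σ = s' ∧ σ ≫ tr hg 𝓜 f = τ)
    (hK : Smooth (𝓜 K).M.hom) (hK' : Smooth (𝓜 K').M.hom)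
    {S'' S' : SchemeOver ℂ} (ι'' : S'' ⟶ (Motives.baseChange ℚ ℂ).obj (𝓜 K).M) [IsOpenImmersion ι''.left]
    (d'' : ℕ) [SmoothOfRelativeDimension d'' S''.hom]
    (ι : S' ⟶ (Motives.baseChange ℚ ℂ).obj (𝓜 K').M) [IsOpenImmersion ι.left] (d : ℕ) [SmoothOfRelativeDimension d S'.hom]
    (s'' : ComplexPoints S'') (s : ComplexPoints S')
    (h : AlgPoints.map ((Motives.baseChange ℚ ℂ).map (tr hg 𝓜 f)) (AlgPoints.map ι'' s'') = AlgPoints.map ι s) :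
    d ≤ d'' := by
  haveI : Smooth ((Motives.baseChange ℚ ℂ).obj (𝓜 K).M).hom := by
    change Smooth (pullback.snd (𝓜 K).M.hom _); infer_instance
  haveI : Smooth ((Motives.baseChange ℚ ℂ).obj (𝓜 K').M).hom := by
    change Smooth (pullback.snd (𝓜 K').M.hom _); infer_instance
  haveI : LocallyOfFiniteType ((Motives.baseChange ℚ ℂ).obj (𝓜 K').M).hom := inferInstance
  have h' : s'' ≫ ι'' ≫ (Motives.baseChange ℚ ℂ).map (tr hg 𝓜 f) = s ≫ ι := by
    simpa only [AlgPoints.map_apply, Category.assoc] using h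
  exact Literature.AlgebraicGeometry.Morphisms.relDim_le_of_dualNumber_lifts _ ι'' d'' ι d s'' s h'
    (fun τ hτ => Motives.dualNumber_lifts_baseChange (tr hg 𝓜 f) hγ (s'' ≫ ι'') τ hτ)

/-- **`TrLiftsRelDim` — `tr_f` LIFTS RELATIVE DIMENSION AT EVERY `ℂ`-POINT, UNCONDITIONALLY in (F)-smoothness** (the `hLift`
hypothesis of ★ `EquidimThickLift.exists_lift_le_relDim`, discharged): `relDim_le_of_tr` at (R4-γ) ★
`SiegelModuliTower.exists_lift_dualNumber` (the unique infinitesimal lifting of level structures along `Spec ℂ → Spec ℂ[ε]`).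
[cite: MumfordFogartyKirwan1994, App. 7A (p. 235)] [cite: GortzWedhorn2020, (6.4) Prop. 6.7] -/
theorem trLiftsRelDim (hg : 0 < g) (𝓜 : ∀ K : SiegelLevel δ, SiegelFineModuliScheme g K.N δ) {K K' : SiegelLevel δ}
    (f : K ⟶ K') (hK : Smooth (𝓜 K).M.hom) (hK' : Smooth (𝓜 K').M.hom)
    {S'' S' : SchemeOver ℂ} (ι'' : S'' ⟶ (Motives.baseChange ℚ ℂ).obj (𝓜 K).M) [IsOpenImmersion ι''.left]
    (d'' : ℕ) [SmoothOfRelativeDimension d'' S''.hom]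
    (ι : S' ⟶ (Motives.baseChange ℚ ℂ).obj (𝓜 K').M) [IsOpenImmersion ι.left] (d : ℕ) [SmoothOfRelativeDimension d S'.hom]
    (s'' : ComplexPoints S'') (s : ComplexPoints S')
    (h : AlgPoints.map ((Motives.baseChange ℚ ℂ).map (tr hg 𝓜 f)) (AlgPoints.map ι'' s'') = AlgPoints.map ι s) :
    d ≤ d'' :=
  relDim_le_of_tr hg 𝓜 f (exists_lift_dualNumber hg 𝓜 f) hK hK' ι'' d'' ι d s'' s h

end Literature.AlgebraicGeometry.ModuliOfAbelianVarieties.SiegelModuliTower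

end
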